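import Summits.BirchSwinnertonDyer.BirchSwinnertonDyer.Theorems.TwoAdicConverseMultLambdaWallNonsplit
import Summits.BirchSwinnertonDyer.BirchSwinnertonDyer.Theorems.TwoAdicConverseMultLambdaRoadWeakEZ
import HarnessLib

/-!
# Route `TwoAdicConverse` (rung S3), multiplicative branch, SPLIT sign: the research WALL of LINE `cycint` in
# `λ`-FORM on the per-curve K11 binder — items stmt-BirchSwinnertonDyer-19219 `MultiplicativeRankZeroTwoConverse` /
# 19187 `MultTwoConverseOverKAtTwo` (helper; composition of the LINE `cycint` v5 candidate)

Cell `bsd-2adic` (run/shared/lean/pub/bsd-2adic/), seat `bsd-2adic-conv-2` (GEN 13). THEOREMS ONLY — nothing asserted, no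
definition, no named fact, no class booked; BSD is not proved by any of this. PARTITION (D-0054): none — RANK axis (S3 mult,
split sign); companion formula cell X5@2 mult (K4ᵐ, B1·O1; 703 split of 1 976 book230 classes).

WHY THIS FILE EXISTS. GEN 12 (`Theorems/TwoAdicConverseMultLambdaWallNonsplit.lean`, p491683) re-shaped the NON-SPLIT research
stub of LINE `cycint` (crux 19187) from the INTEGRAL Eisenstein direction at some isogenous member (v3; `μ`- and period-sensitive)
to the `λ`-form wall λ-WALL-ns on the K11a kernel, and recorded (census R-GEN12-3) that the SPLIT stub was NOT moved because
Kato's `⊗ℚ` divisibility at a SPLIT `2` (K11b-Rat) still rests on the Summits constant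
`MultKatoInputs.exists_multDivisibilityInputs_split_two` (memo PROOF-KATO2SPLIT; seat bsd-2adic-mult GEN 11 is typing its
PRINT-located descent twin). This file does the split re-shape WITHOUT choosing the feed: every door below displays the cell's
sign-uniform PER-CURVE binder `X5.O1.KatoMultiplicativeDivisibilityRat W 2` (K11: `X` torsion and `T·char X ∣ 2ⁿ·L₂` at a split
`2`), which is supplied TODAY by `MultKatoRat.katoMultiplicativeDivisibilityRat_two_of_descent_of_split_inputs` (non-split half
PRINT-located, split half from the Summits constant — §5 shows that feed explicitly, as a DISPLAYED hypothesis) and TOMORROW,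
with no edit here, by the split descent kernel. The research object of the split sign becomes

  **λ-WALL-sp**: for every non-CM globally minimal `W` SPLIT multiplicative at `2` with `corank_{ℤ₂} Sel_{2^∞}(W/ℚ) = 0`, every
  cyclotomic datum, newform `f` of `W`, dual datum `D` with `char_Λ X = (g)`, and every `h ∈ Λ`, `n` with
  `ι(T·g·h) = 2ⁿ·L₂(f)` (`IsSplitMultPAdicLFunctionOf f 2 L₂`; the trivial zero `L₂(0) = 0` is charged to the factor `T`):
  `g·h ≠ 0` and `λ(g·h) ≤ λ(g)` — i.e. «`λ_an ≤ λ_alg + 1`» AT `W` (no `μ`, no period `ϖ`, no isogeny hedge, no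
  Greenberg–Stevens: the exceptional zero is handled by Spieß 2014 Thm. 5.7, PRINT)

— exactly the split conjunct of the `λ`-part binder of this seat's GEN 0 λ-road (`multiplicativeRankZeroTwoConverse_of_lambdaPart`,
p419187) restricted to the finite-`Sel` locus. This file proves, by name and sorry-free:

* §1 the per-curve door `analyticRank_eq_zero_of_selmerCorank_eq_zero_split_two_of_lambdaPart_of_katoRat`: PRINT {A236
  `h41sp`, modularity `hmod`, Spieß Thm. 5.7 at `(W,2)` `hW`} + K11 at `W` (`hKato`) + the split `λ`-part at `W` ⟹ (`corank 0 ⇒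
  L(E,1) ≠ 0 ∧ r_an = 0`) — composition p419187 §2 (`multLowerDivisibilityAtTwoRat_of_katoRat_of_lambdaPart`, non-split clause
  vacuous) ∘ the weak-EZ split door `analyticRank_eq_zero_of_finite_selmer_split_two_of_weakEZ` (GEN 9, p468538);
* §2 the SPLIT HALF of 19219 from λ-WALL-sp (`splitMultRankZeroTwoConverse_of_lamWallSplit_of_katoRat`; binder
  `hKsp : ∀ W split at 2, KatoMultiplicativeDivisibilityRat W 2`);
* §3 the crux `MultiplicativeRankZeroTwoConverse` (19219) and the SERVED crux `MultTwoConverseOverKAtTwo` (19187) BY NAME from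
  {λ-WALL-ns (v4 stub verbatim, K11a kernel inputs `hne`/`h12`/`hdesc`/`h15`), λ-WALL-sp, `hKsp`, PRINT} — the composition of a
  LINE `cycint` v5 CANDIDATE whose two research stubs are BOTH in `λ`-form (registered only once `hKsp` is PRINT-located);
* §4 today's feed made explicit: with the Summits constant `exists_multDivisibilityInputs_split_two` DISPLAYED as a hypothesis
  (memo-grade, never a Literature fact) the binder `hKsp` is discharged by mult GEN 10's
  `MultKatoRat.katoMultiplicativeDivisibilityRat_two_of_descent_of_split_inputs` (p487637); nothing is registered on that constant.
The T1 strength bookkeeping (member-wise integral ⟹ `λ`-part; v4's isogeny-hedged split stub ⟹ λ-WALL-sp modulo K11 at the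
isogenous member) is the companion file `Theorems/TwoAdicConverseMultLambdaWallSplitIsogeny.lean`.

HONEST FRAMING. λ-WALL-sp is NOT in print at `p = 2` (Skinner 2016 Thm. A/B: `p ≥ 3`; Greenberg–Vatsal 2000: `p` odd; the
split `2` carries the exceptional zero on top); restricted to the finite-`Sel` locus it still says more than the converse
(every zero of `f_X`, not only `T = 0`); the rank-`0` 2-converse at a multiplicative `2` stays OPEN class-wide; nothing is booked.

References: Kato, Astérisque 295 (2004) Thm. 12.5 (3), Thm. 17.4, §17.13 [Kato2004Asterisque]; Greenberg, LNM 1716 (1999) Thm. 1.5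
(p. 61), §4 pp. 112–113 [GreenbergLNM1716]; Greenberg–Vatsal, Invent. Math. 142 (2000) p. 4 [GreenbergVatsal2000];
Mazur–Tate–Teitelbaum, Invent. Math. 84 (1986) §I.14–15, §II.10 [MazurTateTeitelbaum1986Invent]; Spieß, Invent. Math. 196 (2014)
Thm. 5.7 [Spiess2014Invent]; Skinner, Pacific J. Math. 283 (2016) Thm. A/B [Skinner2016PacificMC]; Kobayashi, Doc. Math. Extra
Vol. Coates (2006) Thm. 4.1 [Kobayashi2006DocMath].
-/


set_option linter.dupNamespace false
set_option autoImplicit false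

noncomputable section

open scoped Classical MatrixGroups ModularForm

open CongruenceSubgroup WeierstrassCurve Literature.NumberTheory.EllipticCurves
  Literature.NumberTheory.EllipticCurves.ModularForms
  Literature.NumberTheory.EllipticCurves.Greenberg1999
  Literature.NumberTheory.EllipticCurves.Spiess2014
  Literature.NumberTheory.EllipticCurves.Rank1Residual
  Literature.NumberTheory.EllipticCurves.Rank1Residual.Typed
  Summit.BirchSwinnertonDyer.Rank1Residual.X1.MuLambda
  Summit.BirchSwinnertonDyer.Rank1Residual.X5
  Summit.BirchSwinnertonDyer.Rank1Residual.X5.O1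
  Summit.BirchSwinnertonDyer.BirchSwinnertonDyer.Theses.TwoAdicConverse
  Summit.BirchSwinnertonDyer.BirchSwinnertonDyer.Theorems.MultKatoInputs

namespace Summit.BirchSwinnertonDyer.BirchSwinnertonDyer.Theorems

namespace MultLambdaWall

/-! ## §1 The per-curve door at a SPLIT multiplicative `2`: K11 at `W` + the split `λ`-part at `W` + PRINT -/

section PerCurve

variable (W : WeierstrassCurve ℚ) [W.IsElliptic] [W.IsGloballyMinimal]

/-- **Rank-`0` `2`-converse at a SPLIT multiplicative `2` from the split `λ`-part at `W`, K11 at `W` and PRINT only** (no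
Greenberg–Stevens, no `μ`, no period). `E/ℚ` (globally minimal `W`) split multiplicative at `2`; PRINT {Greenberg's split
display A236 `h41sp`, modularity `hmod`, Spieß 2014 Thm. 5.7 at `(W,2)` `hW` (weak exceptional-zero vanishing)}; the
per-curve K11 binder `hKato : KatoMultiplicativeDivisibilityRat W 2` (`X` torsion; `T·char X ∣ 2ⁿ·L₂`); and the split
`λ`-PART at `W` (`hlam`: for every cyclotomic datum, newform `f` of `W`, dual datum `D` with `char_Λ X = (g)`, every `h`, `n`
with `ι(T·g·h) = 2ⁿ·L₂(f)`: `g·h ≠ 0 ∧ λ(g·h) ≤ λ(g)`). If `corank_{ℤ₂} Sel_{2^∞}(E/ℚ) = 0` then `L(E,1) ≠ 0` and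
`r_an(E) = 0`. Chain: K11 + `hlam` ⟹ T-mult-4 `⊗ℚ` at `W` (`multLowerDivisibilityAtTwoRat_of_katoRat_of_lambdaPart`, the
non-split clause being vacuous) ⟹ the weak-EZ split door `analyticRank_eq_zero_of_finite_selmer_split_two_of_weakEZ` (A236:
`f_E(0) ≠ 0`; T-mult-4: `[T¹]L₂ ≠ 0`; Spieß: `[0]⁺_f ≠ 0`). [cite: Spiess2014Invent, Thm. 5.7 (F = ℚ, r = 1)]
[cite: GreenbergLNM1716, §4 pp. 112–113] [cite: Kato2004Asterisque, Thm. 17.4 and §17.13 (pp. 279–280; shape)]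
[cite: GreenbergVatsal2000, p. 4 (after Thm. (1.2))] -/
theorem analyticRank_eq_zero_of_selmerCorank_eq_zero_split_two_of_lambdaPart_of_katoRat
    (h41sp : thm41Analogue_charValue_rankZero_split_baseChange_anyPrime)
    (hmod : nonempty_modularParametrizationData)
    (hW : thm57_weakExceptionalZero_splitMultiplicative_rat W 2)
    (hKato : KatoMultiplicativeDivisibilityRat W 2)
    (hmult : Mult W 2) (hsp : W.HasSplitMultiplicativeReductionAtPrime 2)
    (hlam : ∀ (κ : ZpExtension ℚ 2) (γ : Field.absoluteGaloisGroup ℚ), κ.IsCyclotomic →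
      κ.IsTopGenerator γ → IsCyclotomicVariable 2 γ →
      ∀ ⦃N : ℕ⦄ [NeZero N] (f : CuspForm (Gamma0 N) 2), IsNewformOf W f →
      ∀ (D : W.SelmerDualData κ γ) (g h : IwasawaAlgebra 2) (n : ℕ), D.charIdeal = Ideal.span {g} →
      ∀ L : PowerSeries ℚ_[2], IsSplitMultPAdicLFunctionOf f 2 L →
        iwasawaToPowerSeries 2 (PowerSeries.X * (g * h)) = PowerSeries.C ((2 : ℚ_[2]) ^ n) * L →
        g * h ≠ 0 ∧ lam (g * h) ≤ lam g)
    (hsel : W.selmerCorank 2 = 0) :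
    W.entireLFunction 1 ≠ 0 ∧ W.analyticRank = 0 := by
  have hlow : MultLowerDivisibilityAtTwoRat W :=
    multLowerDivisibilityAtTwoRat_of_katoRat_of_lambdaPart W hKato
      (fun κ γ hκ hγ hγ' _ N _ f hf D g h n hchar =>
        ⟨fun hns => absurd hsp hns, fun _ L hL hι => hlam κ γ hκ hγ hγ' f hf D g h n hchar L hL hι⟩)
  have hfin : Finite (W.selmerGroupPInfty 2) :=
    (finite_selmerGroupPInfty_iff_selmerCorank_eq_zero W 2).mpr hsel
  exact analyticRank_eq_zero_of_finite_selmer_split_two_of_weakEZ W hW h41sp hmod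
    (fun f L => katoDivisibilityAtTwoSplitMultRat_of_multRat W hKato f L) hlow hmult hsp hfin

end PerCurve

/-! ## §2 The SPLIT half of 19219 from λ-WALL-sp -/

/-- **SPLIT half of the crux from λ-WALL-sp + K11 at split-at-`2` curves + PRINT.** PRINT {A236 `h41sp`, modularity `hmod`,
Spieß Thm. 5.7 at every split-at-`2` curve `hW`}, the per-curve K11 binder at every split-at-`2` curve (`hKsp`) and λ-WALL-sp
(`hWlam`: the split `λ`-part at `W`, asked only for non-CM `W` SPLIT multiplicative at `2` with `corank_{ℤ₂} Sel_{2^∞}(W/ℚ) = 0`)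
⟹ for every such `W`: `r_an(W) = 0`. §1 at `W` itself — no isogeny transport, no `μ`, no period, no Greenberg–Stevens. This is
the split road of the LINE `cycint` v5 candidate (replacing v3/v4's `MultSplitWeakEZ.splitMultRankZeroTwoConverse_of_wallS3_of_weakEZ`).
[cite: Spiess2014Invent, Thm. 5.7 (F = ℚ, r = 1)] [cite: GreenbergLNM1716, §4 pp. 112–113]
[cite: Kato2004Asterisque, Thm. 17.4 and §17.13 (pp. 279–280; shape)] [cite: GreenbergVatsal2000, p. 4 (after Thm. (1.2))] -/
theorem splitMultRankZeroTwoConverse_of_lamWallSplit_of_katoRat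
    (h41sp : thm41Analogue_charValue_rankZero_split_baseChange_anyPrime)
    (hmod : nonempty_modularParametrizationData)
    (hW : ∀ (W : WeierstrassCurve ℚ) [W.IsElliptic] [W.IsGloballyMinimal],
      W.HasSplitMultiplicativeReductionAtPrime 2 → thm57_weakExceptionalZero_splitMultiplicative_rat W 2)
    (hKsp : ∀ (W : WeierstrassCurve ℚ) [W.IsElliptic] [W.IsGloballyMinimal],
      W.HasSplitMultiplicativeReductionAtPrime 2 → KatoMultiplicativeDivisibilityRat W 2)
    (hWlam : ∀ (W : WeierstrassCurve ℚ) [W.IsElliptic] [W.IsGloballyMinimal], ¬ W.HasCM → Mult W 2 →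
      W.HasSplitMultiplicativeReductionAtPrime 2 → W.selmerCorank 2 = 0 →
      ∀ (κ : ZpExtension ℚ 2) (γ : Field.absoluteGaloisGroup ℚ), κ.IsCyclotomic →
      κ.IsTopGenerator γ → IsCyclotomicVariable 2 γ →
      ∀ ⦃N : ℕ⦄ [NeZero N] (f : CuspForm (Gamma0 N) 2), IsNewformOf W f →
      ∀ (D : W.SelmerDualData κ γ) (g h : IwasawaAlgebra 2) (n : ℕ), D.charIdeal = Ideal.span {g} →
      ∀ L : PowerSeries ℚ_[2], IsSplitMultPAdicLFunctionOf f 2 L →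
        iwasawaToPowerSeries 2 (PowerSeries.X * (g * h)) = PowerSeries.C ((2 : ℚ_[2]) ^ n) * L →
        g * h ≠ 0 ∧ lam (g * h) ≤ lam g) :
    ∀ (W : WeierstrassCurve ℚ) [W.IsElliptic] [W.IsGloballyMinimal], ¬ W.HasCM → Mult W 2 →
      W.HasSplitMultiplicativeReductionAtPrime 2 → W.selmerCorank 2 = 0 → W.analyticRank = 0 :=
  fun W _ _ hcm hmult hsp hsel =>
    (analyticRank_eq_zero_of_selmerCorank_eq_zero_split_two_of_lambdaPart_of_katoRat W h41sp hmod (hW W hsp)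
      (hKsp W hsp) hmult hsp (hWlam W hcm hmult hsp hsel) hsel).2

/-! ## §3 Both signs in `λ`-form: 19219 and 19187 BY NAME (composition of the LINE `cycint` v5 candidate) -/

/-- **The crux `MultiplicativeRankZeroTwoConverse` (item 19219) from the two `λ`-form walls + K11 + PRINT.** PRINT {A235-twin
`h41ns`, A236 `h41sp`, modularity `hmod`, Greenberg Thm. 1.5 `h15`, Kato `hne`/`h12`, the non-split descent package `hdesc`,
Spieß Thm. 5.7 at every split-at-`2` curve `hW`} + the per-curve K11 binder at split-at-`2` curves (`hKsp`) + λ-WALL-ns (`hWns`,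
v4 stub verbatim) + λ-WALL-sp (`hWsp`) ⟹ 19219, by `multiplicativeRankZeroTwoConverse_iff_bySign` with the non-split half
`nonsplitMultRankZeroTwoConverse_of_lamWallNonsplit_of_descent` (p491683) and the split half of §2.
[cite: Kato2004Asterisque, Thm. 17.4 (1)(2) (p. 273; shape) and §17.13 (pp. 279–280)] [cite: Spiess2014Invent, Thm. 5.7]
[cite: GreenbergLNM1716, §4 pp. 112–113 and Thm. 1.5 (p. 61)] [cite: GreenbergVatsal2000, p. 4 (after Thm. (1.2))] -/
theorem multiplicativeRankZeroTwoConverse_of_lamWalls_of_descent_of_katoRatSplit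
    (h41ns : thm41Analogue_charValue_rankZero_numberField_anyPrime_oddLocalDegree)
    (h41sp : thm41Analogue_charValue_rankZero_split_baseChange_anyPrime)
    (hmod : nonempty_modularParametrizationData) (h15 : thm15_isTorsion_multiplicative_rat)
    (hne : Kato2004.nonempty_iwasawaH1Data) (h12 : Kato2004.thm12_4)
    (hdesc : Kato2004.exists_multDivisibilityInputsDescent_nonsplit)
    (hW : ∀ (W : WeierstrassCurve ℚ) [W.IsElliptic] [W.IsGloballyMinimal],
      W.HasSplitMultiplicativeReductionAtPrime 2 → thm57_weakExceptionalZero_splitMultiplicative_rat W 2)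
    (hKsp : ∀ (W : WeierstrassCurve ℚ) [W.IsElliptic] [W.IsGloballyMinimal],
      W.HasSplitMultiplicativeReductionAtPrime 2 → KatoMultiplicativeDivisibilityRat W 2)
    (hWns : ∀ (W : WeierstrassCurve ℚ) [W.IsElliptic] [W.IsGloballyMinimal], ¬ W.HasCM → Mult W 2 →
      ¬ W.HasSplitMultiplicativeReductionAtPrime 2 → W.selmerCorank 2 = 0 →
      ∀ (κ : ZpExtension ℚ 2) (γ : Field.absoluteGaloisGroup ℚ), κ.IsCyclotomic →
      κ.IsTopGenerator γ → IsCyclotomicVariable 2 γ →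
      ∀ ⦃N : ℕ⦄ [NeZero N] (f : CuspForm (Gamma0 N) 2), IsNewformOf W f →
      ∀ (D : W.SelmerDualData κ γ) (g h : IwasawaAlgebra 2) (n : ℕ), D.charIdeal = Ideal.span {g} →
      ∀ L : PowerSeries ℚ_[2], IsMultPAdicLFunctionOf f 2 (-1) L →
        iwasawaToPowerSeries 2 (g * h) = PowerSeries.C ((2 : ℚ_[2]) ^ n) * L →
        g * h ≠ 0 ∧ lam (g * h) ≤ lam g)
    (hWsp : ∀ (W : WeierstrassCurve ℚ) [W.IsElliptic] [W.IsGloballyMinimal], ¬ W.HasCM → Mult W 2 →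
      W.HasSplitMultiplicativeReductionAtPrime 2 → W.selmerCorank 2 = 0 →
      ∀ (κ : ZpExtension ℚ 2) (γ : Field.absoluteGaloisGroup ℚ), κ.IsCyclotomic →
      κ.IsTopGenerator γ → IsCyclotomicVariable 2 γ →
      ∀ ⦃N : ℕ⦄ [NeZero N] (f : CuspForm (Gamma0 N) 2), IsNewformOf W f →
      ∀ (D : W.SelmerDualData κ γ) (g h : IwasawaAlgebra 2) (n : ℕ), D.charIdeal = Ideal.span {g} →
      ∀ L : PowerSeries ℚ_[2], IsSplitMultPAdicLFunctionOf f 2 L →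
        iwasawaToPowerSeries 2 (PowerSeries.X * (g * h)) = PowerSeries.C ((2 : ℚ_[2]) ^ n) * L →
        g * h ≠ 0 ∧ lam (g * h) ≤ lam g) :
    MultiplicativeRankZeroTwoConverse :=
  multiplicativeRankZeroTwoConverse_iff_bySign.mpr
    ⟨nonsplitMultRankZeroTwoConverse_of_lamWallNonsplit_of_descent h41ns hmod h15 hne h12 hdesc hWns,
      splitMultRankZeroTwoConverse_of_lamWallSplit_of_katoRat h41sp hmod hW hKsp hWsp⟩

/-- **The SERVED crux `MultTwoConverseOverKAtTwo` (item 19187) — composition of the LINE `cycint` v5 candidate.** The route's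
PUB child `MultConversePublishedInputsAtTwo` (`hP`, item 19185) + PRINT {A235-twin, A236, modularity, Thm. 1.5, Kato `hne`/`h12`,
`hdesc`, Spieß Thm. 5.7} + K11 at split-at-`2` curves (`hKsp`) + λ-WALL-ns + λ-WALL-sp ⟹ 19187, through `19219 ⟹ 19187` modulo
PUB (`multTwoConverseOverKAtTwo_of_multiplicativeRankZeroTwoConverse`, p418586).
[cite: Kato2004Asterisque, Cor. 14.3 (p. 235) and §17.13 (pp. 279–280)] [cite: Spiess2014Invent, Thm. 5.7]
[cite: GreenbergLNM1716, §4 pp. 112–113 and Thm. 1.5 (p. 61)] -/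
theorem multTwoConverseOverKAtTwo_of_lamWalls_of_descent_of_katoRatSplit (hP : MultConversePublishedInputsAtTwo)
    (h41ns : thm41Analogue_charValue_rankZero_numberField_anyPrime_oddLocalDegree)
    (h41sp : thm41Analogue_charValue_rankZero_split_baseChange_anyPrime)
    (hmod : nonempty_modularParametrizationData) (h15 : thm15_isTorsion_multiplicative_rat)
    (hne : Kato2004.nonempty_iwasawaH1Data) (h12 : Kato2004.thm12_4)
    (hdesc : Kato2004.exists_multDivisibilityInputsDescent_nonsplit)
    (hW : ∀ (W : WeierstrassCurve ℚ) [W.IsElliptic] [W.IsGloballyMinimal],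
      W.HasSplitMultiplicativeReductionAtPrime 2 → thm57_weakExceptionalZero_splitMultiplicative_rat W 2)
    (hKsp : ∀ (W : WeierstrassCurve ℚ) [W.IsElliptic] [W.IsGloballyMinimal],
      W.HasSplitMultiplicativeReductionAtPrime 2 → KatoMultiplicativeDivisibilityRat W 2)
    (hWns : ∀ (W : WeierstrassCurve ℚ) [W.IsElliptic] [W.IsGloballyMinimal], ¬ W.HasCM → Mult W 2 →
      ¬ W.HasSplitMultiplicativeReductionAtPrime 2 → W.selmerCorank 2 = 0 →
      ∀ (κ : ZpExtension ℚ 2) (γ : Field.absoluteGaloisGroup ℚ), κ.IsCyclotomic →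
      κ.IsTopGenerator γ → IsCyclotomicVariable 2 γ →
      ∀ ⦃N : ℕ⦄ [NeZero N] (f : CuspForm (Gamma0 N) 2), IsNewformOf W f →
      ∀ (D : W.SelmerDualData κ γ) (g h : IwasawaAlgebra 2) (n : ℕ), D.charIdeal = Ideal.span {g} →
      ∀ L : PowerSeries ℚ_[2], IsMultPAdicLFunctionOf f 2 (-1) L →
        iwasawaToPowerSeries 2 (g * h) = PowerSeries.C ((2 : ℚ_[2]) ^ n) * L →
        g * h ≠ 0 ∧ lam (g * h) ≤ lam g)
    (hWsp : ∀ (W : WeierstrassCurve ℚ) [W.IsElliptic] [W.IsGloballyMinimal], ¬ W.HasCM → Mult W 2 →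
      W.HasSplitMultiplicativeReductionAtPrime 2 → W.selmerCorank 2 = 0 →
      ∀ (κ : ZpExtension ℚ 2) (γ : Field.absoluteGaloisGroup ℚ), κ.IsCyclotomic →
      κ.IsTopGenerator γ → IsCyclotomicVariable 2 γ →
      ∀ ⦃N : ℕ⦄ [NeZero N] (f : CuspForm (Gamma0 N) 2), IsNewformOf W f →
      ∀ (D : W.SelmerDualData κ γ) (g h : IwasawaAlgebra 2) (n : ℕ), D.charIdeal = Ideal.span {g} →
      ∀ L : PowerSeries ℚ_[2], IsSplitMultPAdicLFunctionOf f 2 L →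
        iwasawaToPowerSeries 2 (PowerSeries.X * (g * h)) = PowerSeries.C ((2 : ℚ_[2]) ^ n) * L →
        g * h ≠ 0 ∧ lam (g * h) ≤ lam g) :
    MultTwoConverseOverKAtTwo :=
  multTwoConverseOverKAtTwo_of_multiplicativeRankZeroTwoConverse hP
    (multiplicativeRankZeroTwoConverse_of_lamWalls_of_descent_of_katoRatSplit h41ns h41sp hmod h15 hne h12 hdesc hW hKsp
      hWns hWsp)

/-! ## §4 Today's feed of the K11 binder, displayed (memo-grade Summits constant; nothing registered on it) -/

/-- **The split K11 binder from the located inputs + the Summits constant, DISPLAYED.** Kato `hne`/`h12`, the non-split descent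
package `hdesc` (PRINT-located), Greenberg Thm. 1.5 `h15` and the Summits `@[conjecture]` constant
`MultKatoInputs.exists_multDivisibilityInputs_split_two` (`hspP`, memo PROOF-KATO2SPLIT — Kobayashi 2006 Thm. 4.1 at `2`; NOT a
Literature fact, displayed as a hypothesis and never counted as progress) give `hKsp` of §2–§3 (and of the companion file), by mult GEN 10's
`MultKatoRat.katoMultiplicativeDivisibilityRat_two_of_descent_of_split_inputs` (p487637). The day the split descent kernel
lands, this lemma is superseded by a PRINT-located feed with no edit to §1–§3.
[cite: Kato2004Asterisque, Thm. 17.4 (1)(2) (p. 273; shape), Thm. 12.5 (3) (p. 222), §17.13 (pp. 279–280)]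
[cite: Kobayashi2006DocMath, Thm. 4.1 (split; odd p in print)] -/
theorem katoRatSplit_of_descent_of_split_inputs (hne : Kato2004.nonempty_iwasawaH1Data) (h12 : Kato2004.thm12_4)
    (hdesc : Kato2004.exists_multDivisibilityInputsDescent_nonsplit) (hspP : exists_multDivisibilityInputs_split_two)
    (h15 : thm15_isTorsion_multiplicative_rat) :
    ∀ (W : WeierstrassCurve ℚ) [W.IsElliptic] [W.IsGloballyMinimal],
      W.HasSplitMultiplicativeReductionAtPrime 2 → KatoMultiplicativeDivisibilityRat W 2 :=
  fun W _ _ _ => MultKatoRat.katoMultiplicativeDivisibilityRat_two_of_descent_of_split_inputs W hne h12 hdesc hspP h15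

/-- **19219 from the two `λ`-form walls with today's feed** — PRINT {A235-twin, A236, modularity, Thm. 1.5, Kato `hne`/`h12`,
`hdesc`, Spieß Thm. 5.7} + MEMO {`hspP`: the Summits constant `exists_multDivisibilityInputs_split_two`, displayed} + λ-WALL-ns +
λ-WALL-sp ⟹ `MultiplicativeRankZeroTwoConverse`. Bookkeeping of what the LINE `cycint` v5 candidate would display TODAY; the
memo binder is the reason v5 is not registered yet (tier: the v4 split stub displays no Kato input at all).
[cite: Kato2004Asterisque, Thm. 17.4 (1)(2) (p. 273; shape) and §17.13 (pp. 279–280)] [cite: Spiess2014Invent, Thm. 5.7]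
[cite: GreenbergLNM1716, §4 pp. 112–113 and Thm. 1.5 (p. 61)] [cite: Kobayashi2006DocMath, Thm. 4.1 (split; odd p in print)] -/
theorem multiplicativeRankZeroTwoConverse_of_lamWalls_of_descent_of_split_inputs
    (h41ns : thm41Analogue_charValue_rankZero_numberField_anyPrime_oddLocalDegree)
    (h41sp : thm41Analogue_charValue_rankZero_split_baseChange_anyPrime)
    (hmod : nonempty_modularParametrizationData) (h15 : thm15_isTorsion_multiplicative_rat)
    (hne : Kato2004.nonempty_iwasawaH1Data) (h12 : Kato2004.thm12_4)
    (hdesc : Kato2004.exists_multDivisibilityInputsDescent_nonsplit) (hspP : exists_multDivisibilityInputs_split_two)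
    (hW : ∀ (W : WeierstrassCurve ℚ) [W.IsElliptic] [W.IsGloballyMinimal],
      W.HasSplitMultiplicativeReductionAtPrime 2 → thm57_weakExceptionalZero_splitMultiplicative_rat W 2)
    (hWns : ∀ (W : WeierstrassCurve ℚ) [W.IsElliptic] [W.IsGloballyMinimal], ¬ W.HasCM → Mult W 2 →
      ¬ W.HasSplitMultiplicativeReductionAtPrime 2 → W.selmerCorank 2 = 0 →
      ∀ (κ : ZpExtension ℚ 2) (γ : Field.absoluteGaloisGroup ℚ), κ.IsCyclotomic →
      κ.IsTopGenerator γ → IsCyclotomicVariable 2 γ →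
      ∀ ⦃N : ℕ⦄ [NeZero N] (f : CuspForm (Gamma0 N) 2), IsNewformOf W f →
      ∀ (D : W.SelmerDualData κ γ) (g h : IwasawaAlgebra 2) (n : ℕ), D.charIdeal = Ideal.span {g} →
      ∀ L : PowerSeries ℚ_[2], IsMultPAdicLFunctionOf f 2 (-1) L →
        iwasawaToPowerSeries 2 (g * h) = PowerSeries.C ((2 : ℚ_[2]) ^ n) * L →
        g * h ≠ 0 ∧ lam (g * h) ≤ lam g)
    (hWsp : ∀ (W : WeierstrassCurve ℚ) [W.IsElliptic] [W.IsGloballyMinimal], ¬ W.HasCM → Mult W 2 →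
      W.HasSplitMultiplicativeReductionAtPrime 2 → W.selmerCorank 2 = 0 →
      ∀ (κ : ZpExtension ℚ 2) (γ : Field.absoluteGaloisGroup ℚ), κ.IsCyclotomic →
      κ.IsTopGenerator γ → IsCyclotomicVariable 2 γ →
      ∀ ⦃N : ℕ⦄ [NeZero N] (f : CuspForm (Gamma0 N) 2), IsNewformOf W f →
      ∀ (D : W.SelmerDualData κ γ) (g h : IwasawaAlgebra 2) (n : ℕ), D.charIdeal = Ideal.span {g} →
      ∀ L : PowerSeries ℚ_[2], IsSplitMultPAdicLFunctionOf f 2 L →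
        iwasawaToPowerSeries 2 (PowerSeries.X * (g * h)) = PowerSeries.C ((2 : ℚ_[2]) ^ n) * L →
        g * h ≠ 0 ∧ lam (g * h) ≤ lam g) :
    MultiplicativeRankZeroTwoConverse :=
  multiplicativeRankZeroTwoConverse_of_lamWalls_of_descent_of_katoRatSplit h41ns h41sp hmod h15 hne h12 hdesc hW
    (katoRatSplit_of_descent_of_split_inputs hne h12 hdesc hspP h15) hWns hWsp

end MultLambdaWall

end Summit.BirchSwinnertonDyer.BirchSwinnertonDyer.Theorems

end
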